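import Summits.AnomalousDissipation.AnomalousDissipation.Theorems.SawtoothPulseCascadeK1LocalisedCascadeCanonicalStripSteps
import Summits.AnomalousDissipation.AnomalousDissipation.Theorems.SawtoothPulseCascadeK1LocalisedCascadeStripBlocksOsc
import Summits.AnomalousDissipation.AnomalousDissipation.Theorems.SawtoothPulseCascadeK1LocalisedCascadeBlockJunkOscGeom
import Summits.AnomalousDissipation.AnomalousDissipation.Theorems.SawtoothPulseCascadeK1LocalisedCascadeCanonicalThinBlockJunk
import Summits.AnomalousDissipation.AnomalousDissipation.Theorems.SawtoothPulseCascadeK1LocalisedCascadeLedgerArith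

/-!
# K1loc — helper: THE STRIP STEPS (T-H), (S-V) ON THE THIN BLOCK GEOMETRY, OSCILLATORY GRADE (uniform constants)

Helper file of the prover lane on the crux `K1LocalisedCascade` (stmt-AnomalousDissipation-19491), route `SawtoothPulseCascade`
(S-B/S-C assembly seat; the LEDGER ASSEMBLY, thin tail).  In the THIN phases (threshold ratio `γ² − 3 = 61`; window top `K` a few percent
below the chirp shift `GΛ₀` of the fibre floor) the strip steps of `…StripBlocksOsc` run over ad-k1loc-p3's thin block family
`Λ_m = (Λ₀ + s·min(m,H))·2^{m−H}` (`…CanonicalThinBlocks`: arithmetic head of step `s`, doubling tail from `Λ_H = Λ₀ + sH`), window tops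
`K + Q₂^m`, `Q₂^m = ⌊θ_n(GΛ_m − K)/θ_d⌋`, feed cut-offs `Q₁^m = ⌊u′Λ_{m+1}/v′⌋`, the canonical oscillatory depth of `…BlockJunkOsc`,
and UNIFORM block constants — enough for the tail phases `j ≥ 12` of the ledger, where every junk term is `≲ 10⁻⁴`:
`r_m ≤ r* = (c_d + c_n)/(c_d − c_n)` (`…CanonicalThinBlockJunk.thin_r_le_all`), `A_m ≤ A* = ((1−θ)K + (1+θ)GΛ_H)/((1−θ)(GΛ₀ − K))`,
`D_m ≥ D₀ = (1−θ)(GΛ₀ − K)` (no growth used: `…BlockJunkOscGeom.blockJunk_osc_sum_le_geom` at `ρ = 1`, `S = M_b`), `θ = θ_n/θ_d`: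
  `J = 3r*²((4/3)(A*πGηΛ_H2^{M_b}/N)² + M_b(2N/(πD₀))² + M_b·4NA*/(πD₀) + M_b(8NA*²√(4Mδ/(πD₀)) + 8A*²Mδ/π))`.
* `lowFibre_hstep_thinOsc_le` (T-H): `T ≤ S(Λ₀) + ((√J + √O(Λ₀))² + ((1+γ)^{2j}/Λ_{M_b})²)`;
* `strip_vstep_thinOsc_le` (S-V): `S′ ≤ T(Λ₀) + ((√J + √C(Y))² + ((1+γ)^{2(j+1)}/Λ_{M_b})²)`.
The scalar side conditions (separation and cut-off fraction at `m = 0`, `m = H` and per increment) are hypotheses in the literal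
shapes of `thin_sep_all` / `thin_frac_all`, discharged by `norm_num`/`decide` at each instance.
No definitions; no statement about the crux. [cite: Grafakos2014, Prop. 3.1.2 (5), Prop. 3.2.7 (3), §3.1.3] [problem: turb]
-/

-- `Summit.<Summit>.<Problem>`: single-conjunct summit, the duplicate namespace segment is deliberate.
set_option linter.dupNamespace false

noncomputable section

namespace Summit.AnomalousDissipation.AnomalousDissipation.Theorems.SawtoothPulseCascade.K1Window

open MeasureTheory Set Filter Topology UnitAddTorus Function Complex Metric
open scoped Real ENNReal
open Literature.Analysis Literature.Analysis.FunctionSpaces Literature.Analysis.FunctionSpaces.Torus Literature.Analysis.FluidPDE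
open Literature.Analysis.FluidPDE.ShearStage
open Literature.Analysis.FluidPDE.SawtoothCascade Literature.Analysis.FluidPDE.SawtoothCascade.CascadeParams
open Summit.AnomalousDissipation.AnomalousDissipation.Theorems.SawtoothPulseCascade.K1Start
open Summit.AnomalousDissipation.AnomalousDissipation.Theorems.SawtoothPulseCascade.K1Flat
open Summit.AnomalousDissipation.AnomalousDissipation.Theorems.SawtoothPulseCascade.K1Ledger.From

/-! ## §1 Uniform facts of the thin block family -/

/-- **The thin blocks stay below `Λ_H·2^k`**: `(Λ₀ + s·min(k,H))·2^{k−H} ≤ (Λ₀ + sH)·2^k`. [folklore] -/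
theorem thin_blocks_le_top_pow (Λ0 s H k : ℕ) : (Λ0 + s * min k H) * 2 ^ (k - H) ≤ (Λ0 + s * H) * 2 ^ k :=
  Nat.mul_le_mul (Nat.add_le_add_left (Nat.mul_le_mul_left _ (min_le_right _ _)) _)
    (Nat.pow_le_pow_right (by norm_num) (Nat.sub_le _ _))

/-- **The uniform ratio constant**: for `θ < 1`, `0 ≤ K < L₀ ≤ L` and `L₀ ≤ L_H`,
`((1−θ)K + (1+θ)L)/((1−θ)(L − K)) ≤ ((1−θ)K + (1+θ)L_H)/((1−θ)(L₀ − K))` (antitone in `L` beyond `L_H`, monotone numerator and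
antitone denominator below). [folklore] -/
theorem thin_Abound_le_uniform {θ K L L₀ LH : ℝ} (hθ0 : 0 ≤ θ) (hθ1 : θ < 1) (hK0 : 0 ≤ K) (hKL : K < L₀) (hL : L₀ ≤ L)
    (hLH : L₀ ≤ LH) :
    ((1 - θ) * K + (1 + θ) * L) / ((1 - θ) * (L - K)) ≤ ((1 - θ) * K + (1 + θ) * LH) / ((1 - θ) * (L₀ - K)) := by
  have h1θ : 0 < 1 - θ := by linarith
  have h1θ' : 0 ≤ 1 + θ := by linarith
  have hden0 : 0 < (1 - θ) * (L₀ - K) := mul_pos h1θ (by linarith)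
  have hnum : 0 ≤ (1 - θ) * K + (1 + θ) * LH := add_nonneg (mul_nonneg h1θ.le hK0) (mul_nonneg h1θ' (by linarith))
  rcases le_total L LH with hle | hge
  · -- below `L_H`: numerator up, denominator down
    have hden : (1 - θ) * (L₀ - K) ≤ (1 - θ) * (L - K) := mul_le_mul_of_nonneg_left (by linarith) h1θ.le
    calc ((1 - θ) * K + (1 + θ) * L) / ((1 - θ) * (L - K))
        ≤ ((1 - θ) * K + (1 + θ) * LH) / ((1 - θ) * (L - K)) :=
          div_le_div_of_nonneg_right (by nlinarith [mul_le_mul_of_nonneg_left hle h1θ']) (hden0.le.trans hden)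
      _ ≤ ((1 - θ) * K + (1 + θ) * LH) / ((1 - θ) * (L₀ - K)) :=
          div_le_div_of_nonneg_left hnum hden0 hden
  · -- beyond `L_H`: antitone down to `L_H`, then the denominator
    have h1 := thin_Abound_antitone hθ1 hK0 (lt_of_lt_of_le hKL hLH) hge
    have hden : (1 - θ) * (L₀ - K) ≤ (1 - θ) * (LH - K) := mul_le_mul_of_nonneg_left (by linarith) h1θ.le
    exact h1.trans (div_le_div_of_nonneg_left hnum hden0 hden)

section Cascade

variable (P : CascadeParams)

set_option maxHeartbeats 800000 in
/-- **(T-H) ON THIN BLOCKS, UNIFORM CONSTANTS** (see the file header).  Inputs: shape `γ = G`; window top `K < GΛ₀`; head step `s`, head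
length `H`; `θ_n < θ_d`; feed slope `(u′, v′)` (`v′ > 0`), cut-off fraction `c_n < c_d`; the separation facts of `thin_sep_all` and the fraction
facts of `thin_frac_all` (at `m = 0`, per increment, at `m = H`); `M_b` blocks; rounding target `η > 0` with `max(1,√(2log(1/η)))·δ_j < π/2`.
[cite: Grafakos2014, Prop. 3.1.2 (5), Prop. 3.2.7 (3), §3.1.3] -/
theorem lowFibre_hstep_thinOsc_le {G : ℕ} (hγ : P.γ = G) (hδ₀ : 0 < P.δ₀) (hd : 0 < P.d) (hN₀ : 1 ≤ P.N₀)
    (hρN : 1 ≤ P.ρN) (a b : ℕ → UnitAddTorus (Fin 2) → ℝ) (has : ∀ j, IsSmooth (a j)) (h0 : a 0 = datum)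
    (hb : ∀ j, b j = a j ∘ shearMap 0 1 (amp ⟨P.U j, P.U_periodic j, P.contDiff_U (P.δ_pos hδ₀ hd j)⟩ P.γ))
    (hab : ∀ j, a (j + 1) = b j ∘ shearMap 1 0 (amp ⟨P.U j, P.U_periodic j, P.contDiff_U (P.δ_pos hδ₀ hd j)⟩ P.γ))
    (j : ℕ) {K u' v' θn θd cn cd Λ0 s H : ℕ} (hθd : 0 < θd) (hθ : θn < θd) (hv' : 0 < v') (hcd : 0 < cd) (hc : cn < cd)
    (hK : K < G * Λ0)
    (hsep0 : θd * (u' * ((Λ0 + s * min 1 H) * 2 ^ (1 - H)) + v') ≤ v' * θn * (G * Λ0 - K))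
    (hsepi : θd * u' ≤ v' * θn * G)
    (hsepH : θd * (u' * ((Λ0 + s * min (H + 1) H) * 2 ^ (H + 1 - H)) + v') ≤ v' * θn * (G * (Λ0 + s * H) - K))
    (hfr0 : cd * (u' * ((Λ0 + s * min 1 H) * 2 ^ (1 - H))) ≤ cn * (v' * (θn * (G * ((Λ0 + s * min 0 H) * 2 ^ (0 - H)) - K) / θd)))
    (hfri : cd * (u' * s) ≤ cn * (v' * (θn * (G * s) / θd)))
    (hfrH : cd * (u' * ((Λ0 + s * min (H + 1) H) * 2 ^ (H + 1 - H))) ≤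
      cn * (v' * (θn * (G * ((Λ0 + s * min H H) * 2 ^ (H - H)) - K) / θd)))
    (Mb : ℕ) {η : ℝ} (hη : 0 < η) (hMδ : max 1 (Real.sqrt (2 * Real.log (1 / η))) * P.δ j < π / 2) :
    ∑' k : Fin 2 → ℤ, (if |k 1| < (K : ℤ) then (1 : ℝ) else 0) * ‖mFourierCoeff (fun x => (b j x : ℂ)) k‖ ^ 2 ≤
      ∑' k : Fin 2 → ℤ, (if |k 0| < (Λ0 : ℤ) then (1 : ℝ) else 0) * ‖mFourierCoeff (fun x => (a j x : ℂ)) k‖ ^ 2 +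
      ((Real.sqrt (3 * (((cd : ℝ) + cn) / ((cd : ℝ) - cn)) ^ 2 *
            (4 / 3 * ((((1 - (θn : ℝ) / θd) * K + (1 + (θn : ℝ) / θd) * ((G : ℝ) * (Λ0 + s * H))) /
                ((1 - (θn : ℝ) / θd) * ((G : ℝ) * Λ0 - K))) * π * G * η * (Λ0 + s * H) / P.N j * 2 ^ Mb) ^ 2 +
              Mb * (2 * P.N j / (π * ((1 - (θn : ℝ) / θd) * ((G : ℝ) * Λ0 - K)))) ^ 2 +
              Mb * (4 * P.N j * (((1 - (θn : ℝ) / θd) * K + (1 + (θn : ℝ) / θd) * ((G : ℝ) * (Λ0 + s * H))) /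
                ((1 - (θn : ℝ) / θd) * ((G : ℝ) * Λ0 - K))) / (π * ((1 - (θn : ℝ) / θd) * ((G : ℝ) * Λ0 - K)))) +
              Mb * (8 * P.N j * (((1 - (θn : ℝ) / θd) * K + (1 + (θn : ℝ) / θd) * ((G : ℝ) * (Λ0 + s * H))) /
                ((1 - (θn : ℝ) / θd) * ((G : ℝ) * Λ0 - K))) ^ 2 *
                Real.sqrt (4 * (max 1 (Real.sqrt (2 * Real.log (1 / η))) * P.δ j) / (π * ((1 - (θn : ℝ) / θd) * ((G : ℝ) * Λ0 - K)))) +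
                8 * (((1 - (θn : ℝ) / θd) * K + (1 + (θn : ℝ) / θd) * ((G : ℝ) * (Λ0 + s * H))) /
                ((1 - (θn : ℝ) / θd) * ((G : ℝ) * Λ0 - K))) ^ 2 * (max 1 (Real.sqrt (2 * Real.log (1 / η))) * P.δ j) / π))) +
          Real.sqrt (∑' k : Fin 2 → ℤ, (if (Λ0 : ℤ) ≤ |k 0| ∧ (u' : ℤ) * |k 0| ≤ (v' : ℤ) * |k 1| then (1 : ℝ) else 0) *
            ‖mFourierCoeff (fun x => (a j x : ℂ)) k‖ ^ 2)) ^ 2 +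
        ((1 + P.γ) ^ (2 * j) / (((Λ0 + s * min Mb H) * 2 ^ (Mb - H) : ℕ) : ℝ)) ^ 2) := by
  -- the thin data
  set M : ℝ := max 1 (Real.sqrt (2 * Real.log (1 / η))) with hMdef
  have hM : 1 ≤ M := (zoneDepth_facts hη).1
  have hMη : Real.exp (-(M ^ 2 / 2)) ≤ η := (zoneDepth_facts hη).2
  have hN : (0 : ℝ) < P.N j := by exact_mod_cast P.N_pos hN₀ hρN j
  have hδ : 0 < P.δ j := P.δ_pos hδ₀ hd j
  have hMδ0 : 0 < M * P.δ j := mul_pos (by linarith) hδ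
  set Λb : ℕ → ℕ := fun m => (Λ0 + s * min m H) * 2 ^ (m - H) with hΛb
  set Q₁ : ℕ → ℕ := fun m => u' * Λb (m + 1) / v' with hQ₁
  set Q₂ : ℕ → ℕ := fun m => θn * (G * Λb m - K) / θd with hQ₂
  set A : ℕ → ℝ := fun m => (((K + Q₂ m : ℕ) : ℝ) + ((Λb m * G : ℕ) : ℝ)) /
    (((Λb m * G : ℕ) : ℝ) - ((K + Q₂ m : ℕ) : ℝ)) with hA
  set Dm : ℕ → ℝ := fun m => ((Λb m * G : ℕ) : ℝ) - ((K + Q₂ m : ℕ) : ℝ) with hDm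
  set θ : ℝ := (θn : ℝ) / θd with hθdef
  set As : ℝ := ((1 - θ) * K + (1 + θ) * ((G : ℝ) * (Λ0 + s * H))) / ((1 - θ) * ((G : ℝ) * Λ0 - K)) with hAs
  set D₀ : ℝ := (1 - θ) * ((G : ℝ) * Λ0 - K) with hD₀
  set rs : ℝ := ((cd : ℝ) + cn) / ((cd : ℝ) - cn) with hrs
  have hθdr : (0 : ℝ) < θd := by exact_mod_cast hθd
  have hθ1 : θ < 1 := by rw [hθdef, div_lt_one hθdr]; exact_mod_cast hθ
  have hθ0 : 0 ≤ θ := by positivity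
  have hKr : (K : ℝ) < (G : ℝ) * Λ0 := by exact_mod_cast hK
  have hD₀pos : 0 < D₀ := by rw [hD₀]; nlinarith
  -- block facts
  have hΛ0 : Λb 0 = Λ0 := thin_blocks_zero Λ0 s H
  have hge : ∀ m, Λ0 ≤ Λb m := fun m => thin_blocks_ge Λ0 s H m
  have hKm : ∀ m, K < G * Λb m := fun m => thin_K_lt_of_le hK (hge m)
  have hΛQ : ∀ m, K + Q₂ m < Λb m * G := fun m => thin_strip_shift hθ (hKm m)
  have hsep : ∀ m, θd * (u' * Λb (m + 1) + v') ≤ v' * θn * (G * Λb m - K) := fun m => thin_sep_all hK.le hsep0 hsepi hsepH m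
  have hQ : ∀ m, Q₁ m < Q₂ m := fun m => thin_Q₁_lt_Q₂ hv' hθd (hsep m)
  have hfeed : ∀ m, u' * Λb (m + 1) ≤ v' * (Q₁ m + 1) := fun m => thin_feed u' hv' (Λb (m + 1))
  have hhead : ∀ m, m < H → Λb (m + 1) = Λb m + s := fun m hm => thin_blocks_succ_head hm
  have htail : ∀ m, H ≤ m → Λb (m + 1) = 2 * Λb m := fun m hm => thin_blocks_succ_tail hm
  have hge0 : ∀ m, Λb 0 ≤ Λb m := fun m => by rw [hΛ0]; exact hge m
  have hK0 : K ≤ G * Λb 0 := by rw [hΛ0]; exact hK.le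
  have hfr0' : cd * (u' * Λb 1) ≤ cn * (v' * (θn * (G * Λb 0 - K) / θd)) := hfr0
  have hfrH' : cd * (u' * Λb (H + 1)) ≤ cn * (v' * (θn * (G * Λb H - K) / θd)) := hfrH
  have hrall : ∀ m, 0 ≤ ((Q₁ m : ℝ) + Q₂ m) / ((Q₂ m : ℝ) - Q₁ m) ∧ ((Q₁ m : ℝ) + Q₂ m) / ((Q₂ m : ℝ) - Q₁ m) ≤ rs :=
    fun m => thin_r_le_all hv' hcd hc hhead htail hge0 hK0 hfr0' hfri hfrH' hQ m
  -- the uniform constants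
  have hden : ∀ m, 0 < (1 - θ) * ((G : ℝ) * Λb m - K) ∧ (1 - θ) * ((G : ℝ) * Λb m - K) ≤ Dm m :=
    fun m => thin_den_ge hθd hθ (hKm m)
  have hDge : ∀ m, D₀ * (1 : ℝ) ^ m ≤ Dm m := fun m => by
    rw [one_pow, mul_one]
    refine le_trans ?_ (hden m).2
    have h1 : (Λ0 : ℝ) ≤ Λb m := by exact_mod_cast hge m
    have h2 : (G : ℝ) * Λ0 - K ≤ (G : ℝ) * Λb m - K := by
      have := mul_le_mul_of_nonneg_left h1 (Nat.cast_nonneg G); linarith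
    rw [hD₀]
    exact mul_le_mul_of_nonneg_left h2 (by linarith)
  have hDpos : ∀ m, 0 < Dm m := fun m => lt_of_lt_of_le (by simpa using hD₀pos) (hDge m)
  have hA1 : ∀ m, 1 ≤ A m := fun m => by
    have hd' := hDpos m
    rw [hA, one_le_div hd']
    have h1 : (0 : ℝ) ≤ ((K + Q₂ m : ℕ) : ℝ) := by positivity
    show ((Λb m * G : ℕ) : ℝ) - ((K + Q₂ m : ℕ) : ℝ) ≤ ((K + Q₂ m : ℕ) : ℝ) + ((Λb m * G : ℕ) : ℝ)
    linarith
  have hApos : ∀ m, 0 < A m := fun m => lt_of_lt_of_le one_pos (hA1 m)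
  have hAle : ∀ m, A m ≤ As := fun m => by
    have h1 := thin_A_le (θn := θn) (θd := θd) hθd hθ (hKm m)
    have hL : (G : ℝ) * Λ0 ≤ (G : ℝ) * Λb m := by
      have : (Λ0 : ℝ) ≤ Λb m := by exact_mod_cast hge m
      exact mul_le_mul_of_nonneg_left this (Nat.cast_nonneg _)
    have hLH : (G : ℝ) * Λ0 ≤ (G : ℝ) * (Λ0 + s * H) := mul_le_mul_of_nonneg_left (by
      have : (0 : ℝ) ≤ s * H := by positivity
      linarith) (Nat.cast_nonneg _)
    have h2 := thin_Abound_le_uniform (θ := θ) (K := (K : ℝ)) hθ0 hθ1 (Nat.cast_nonneg _) hKr hL hLH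
    exact h1.trans h2
  set d₀ : ℕ → ℝ := fun m => 1 / (2 * π * A m * Dm m) + Real.sqrt (4 * (M * P.δ j) / (π * A m * Dm m)) +
    M * P.δ j / (π * P.N j) with hd₀
  have hdpos : ∀ m, 0 < d₀ m := fun m => by
    have := hApos m; have := hDpos m
    positivity
  set ε₀ : ℕ → ℝ := fun m => A m * (2 * π * ((Λb (m + 1) * G : ℕ) : ℝ) * (Real.exp (-(M ^ 2 / 2)) / (2 * P.N j))) +
    2 * P.N j / (π * Dm m) with hε₀
  have hε0 : ∀ m, 0 ≤ ε₀ m := fun m => by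
    have := (hApos m).le; have := hDpos m
    positivity
  have hAs0 : 0 ≤ As := (hApos 0).le.trans (hAle 0)
  -- the multi-block step
  have hΛ01 : 1 ≤ Λb 0 := by
    rw [hΛ0]
    exact Nat.pos_of_ne_zero (by rintro rfl; simp at hK)
  have hstep := tsum_lowFibre_hstep_blocks_osc_le P hγ hδ₀ hd hN₀ hρN a b has h0 hb hab j K Λb
    (thin_blocks_monotone Λ0 s H) hΛ01 Mb Q₁ Q₂
    hQ hΛQ hM hMδ d₀ ε₀ hdpos
    (fun m => oscDepth_hMd (M := M) (δ := P.δ j) (hApos m) (hDpos m) hN)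
    (fun m => oscDepth_hAd (hApos m) (hDpos m) hN hMδ0.le) hε0 (fun m => le_rfl) (u' := u') (v' := v')
    hfeed
  -- the junk in closed form (no growth of the denominators used: `ρ = 1`, `S = M_b`)
  have hjunk := blockJunk_osc_sum_le_geom (r := fun m => ((Q₁ m : ℝ) + Q₂ m) / ((Q₂ m : ℝ) - Q₁ m)) (A := A) (D := Dm) (ε₀ := ε₀)
    (rs := rs) (As := As) (D₀ := D₀) (e₀ := As * π * G * η * (Λ0 + s * H) / P.N j) (b₀ := 2 * P.N j / (π * D₀)) (N := (P.N j : ℝ))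
    (Mδ := M * P.δ j) (ρ := 1) (S := Mb) hN hMδ0.le hD₀pos le_rfl
    (fun m => (hrall m).1) (fun m => (hrall m).2) hA1 hAle hDge hε0
    (by positivity) (by positivity) (fun m => ?_) Mb (sum_range_inv_pow_le_card le_rfl Mb)
  · -- assemble
    have e2N : ((2 * P.N j : ℕ) : ℝ) = 2 * (P.N j : ℝ) := by push_cast; ring
    rw [e2N, hΛ0] at hstep
    exact le_add_sq_sqrt_add_mono hstep (hjunk.trans (le_of_eq rfl))
  · -- the rounding allowance on block `m`
    simp only [hε₀]
    have hA' := hAle m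
    have hA0' := (hApos m).le
    have hΛle : ((Λb (m + 1) * G : ℕ) : ℝ) ≤ ((Λ0 : ℝ) + s * H) * 2 ^ (m + 1) * G := by
      have h1 : Λb (m + 1) ≤ (Λ0 + s * H) * 2 ^ (m + 1) := thin_blocks_le_top_pow Λ0 s H (m + 1)
      have h2 : ((Λb (m + 1) * G : ℕ) : ℝ) ≤ (((Λ0 + s * H) * 2 ^ (m + 1) * G : ℕ) : ℝ) := by
        exact_mod_cast Nat.mul_le_mul_right _ h1
      refine h2.trans (le_of_eq ?_)
      push_cast; ring
    have hb : 2 * P.N j / (π * Dm m) ≤ 2 * P.N j / (π * D₀) * (1 / (1 : ℝ)) ^ m := by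
      rw [div_one, one_pow, mul_one]
      exact div_le_div_of_nonneg_left (by positivity) (by positivity)
        (mul_le_mul_of_nonneg_left (by simpa using hDge m) Real.pi_pos.le)
    refine add_le_add ?_ hb
    calc A m * (2 * π * ((Λb (m + 1) * G : ℕ) : ℝ) * (Real.exp (-(M ^ 2 / 2)) / (2 * P.N j)))
        = A m * Real.exp (-(M ^ 2 / 2)) * (π / P.N j) * ((Λb (m + 1) * G : ℕ) : ℝ) := by
          field_simp
      _ ≤ As * η * (π / P.N j) * (((Λ0 : ℝ) + s * H) * 2 ^ (m + 1) * G) :=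
          mul_le_mul (mul_le_mul_of_nonneg_right (mul_le_mul hA' hMη (Real.exp_nonneg _) hAs0) (by positivity)) hΛle
            (by positivity) (by positivity)
      _ = As * π * G * η * (Λ0 + s * H) / P.N j * 2 ^ (m + 1) := by ring


set_option maxHeartbeats 800000 in
/-- **(S-V) ON THIN BLOCKS, UNIFORM CONSTANTS** (see the file header).  Inputs: shape `γ = G`; strip top `K < GΛ₀` (`Λ₀` = floor of the `V`-fibres
of `b_j`); head step `s`, head
length `H`; `θ_n < θ_d`; feed slope `(u′, v′)` (`v′ > 0`), cut-off fraction `c_n < c_d`; the separation facts of `thin_sep_all` and the fraction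
facts of `thin_frac_all` (at `m = 0`, per increment, at `m = H`); feed threshold `Y ≤ Q₁⁰ + 1`; `M_b` blocks; rounding target `η > 0`
with `max(1,√(2log(1/η)))·δ_j < π/2`. [cite: Grafakos2014, Prop. 3.1.2 (5), Prop. 3.2.7 (3), §3.1.3] -/
theorem strip_vstep_thinOsc_le {G : ℕ} (hγ : P.γ = G) (hδ₀ : 0 < P.δ₀) (hd : 0 < P.d) (hN₀ : 1 ≤ P.N₀)
    (hρN : 1 ≤ P.ρN) (a b : ℕ → UnitAddTorus (Fin 2) → ℝ) (has : ∀ j, IsSmooth (a j)) (h0 : a 0 = datum)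
    (hb : ∀ j, b j = a j ∘ shearMap 0 1 (amp ⟨P.U j, P.U_periodic j, P.contDiff_U (P.δ_pos hδ₀ hd j)⟩ P.γ))
    (hab : ∀ j, a (j + 1) = b j ∘ shearMap 1 0 (amp ⟨P.U j, P.U_periodic j, P.contDiff_U (P.δ_pos hδ₀ hd j)⟩ P.γ))
    (j : ℕ) {K u' v' θn θd cn cd Λ0 s H : ℕ} (hθd : 0 < θd) (hθ : θn < θd) (hv' : 0 < v') (hcd : 0 < cd) (hc : cn < cd)
    (hK : K < G * Λ0)
    (hsep0 : θd * (u' * ((Λ0 + s * min 1 H) * 2 ^ (1 - H)) + v') ≤ v' * θn * (G * Λ0 - K))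
    (hsepi : θd * u' ≤ v' * θn * G)
    (hsepH : θd * (u' * ((Λ0 + s * min (H + 1) H) * 2 ^ (H + 1 - H)) + v') ≤ v' * θn * (G * (Λ0 + s * H) - K))
    (hfr0 : cd * (u' * ((Λ0 + s * min 1 H) * 2 ^ (1 - H))) ≤ cn * (v' * (θn * (G * ((Λ0 + s * min 0 H) * 2 ^ (0 - H)) - K) / θd)))
    (hfri : cd * (u' * s) ≤ cn * (v' * (θn * (G * s) / θd)))
    (hfrH : cd * (u' * ((Λ0 + s * min (H + 1) H) * 2 ^ (H + 1 - H))) ≤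
      cn * (v' * (θn * (G * ((Λ0 + s * min H H) * 2 ^ (H - H)) - K) / θd)))
    {Y : ℕ} (hY : Y ≤ u' * ((Λ0 + s * min 1 H) * 2 ^ (1 - H)) / v' + 1)
    (Mb : ℕ) {η : ℝ} (hη : 0 < η) (hMδ : max 1 (Real.sqrt (2 * Real.log (1 / η))) * P.δ j < π / 2) :
    ∑' k : Fin 2 → ℤ, (if |k 0| < (K : ℤ) then (1 : ℝ) else 0) * ‖mFourierCoeff (fun x => (a (j + 1) x : ℂ)) k‖ ^ 2 ≤
      ∑' k : Fin 2 → ℤ, (if |k 1| < (Λ0 : ℤ) then (1 : ℝ) else 0) * ‖mFourierCoeff (fun x => (b j x : ℂ)) k‖ ^ 2 +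
      ((Real.sqrt (3 * (((cd : ℝ) + cn) / ((cd : ℝ) - cn)) ^ 2 *
            (4 / 3 * ((((1 - (θn : ℝ) / θd) * K + (1 + (θn : ℝ) / θd) * ((G : ℝ) * (Λ0 + s * H))) /
                ((1 - (θn : ℝ) / θd) * ((G : ℝ) * Λ0 - K))) * π * G * η * (Λ0 + s * H) / P.N j * 2 ^ Mb) ^ 2 +
              Mb * (2 * P.N j / (π * ((1 - (θn : ℝ) / θd) * ((G : ℝ) * Λ0 - K)))) ^ 2 +
              Mb * (4 * P.N j * (((1 - (θn : ℝ) / θd) * K + (1 + (θn : ℝ) / θd) * ((G : ℝ) * (Λ0 + s * H))) /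
                ((1 - (θn : ℝ) / θd) * ((G : ℝ) * Λ0 - K))) / (π * ((1 - (θn : ℝ) / θd) * ((G : ℝ) * Λ0 - K)))) +
              Mb * (8 * P.N j * (((1 - (θn : ℝ) / θd) * K + (1 + (θn : ℝ) / θd) * ((G : ℝ) * (Λ0 + s * H))) /
                ((1 - (θn : ℝ) / θd) * ((G : ℝ) * Λ0 - K))) ^ 2 *
                Real.sqrt (4 * (max 1 (Real.sqrt (2 * Real.log (1 / η))) * P.δ j) / (π * ((1 - (θn : ℝ) / θd) * ((G : ℝ) * Λ0 - K)))) +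
                8 * (((1 - (θn : ℝ) / θd) * K + (1 + (θn : ℝ) / θd) * ((G : ℝ) * (Λ0 + s * H))) /
                ((1 - (θn : ℝ) / θd) * ((G : ℝ) * Λ0 - K))) ^ 2 * (max 1 (Real.sqrt (2 * Real.log (1 / η))) * P.δ j) / π))) +
          Real.sqrt (∑' k : Fin 2 → ℤ, (if (Y : ℤ) ≤ |k 0| ∧ (u' : ℤ) * |k 1| ≤ (v' : ℤ) * |k 0| then (1 : ℝ) else 0) *
            ‖mFourierCoeff (fun x => (b j x : ℂ)) k‖ ^ 2)) ^ 2 +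
        ((1 + P.γ) ^ (2 * (j + 1)) / (((Λ0 + s * min Mb H) * 2 ^ (Mb - H) : ℕ) : ℝ)) ^ 2) := by
  -- the thin data
  set M : ℝ := max 1 (Real.sqrt (2 * Real.log (1 / η))) with hMdef
  have hM : 1 ≤ M := (zoneDepth_facts hη).1
  have hMη : Real.exp (-(M ^ 2 / 2)) ≤ η := (zoneDepth_facts hη).2
  have hN : (0 : ℝ) < P.N j := by exact_mod_cast P.N_pos hN₀ hρN j
  have hδ : 0 < P.δ j := P.δ_pos hδ₀ hd j
  have hMδ0 : 0 < M * P.δ j := mul_pos (by linarith) hδ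
  set Λb : ℕ → ℕ := fun m => (Λ0 + s * min m H) * 2 ^ (m - H) with hΛb
  set Q₁ : ℕ → ℕ := fun m => u' * Λb (m + 1) / v' with hQ₁
  set Q₂ : ℕ → ℕ := fun m => θn * (G * Λb m - K) / θd with hQ₂
  set A : ℕ → ℝ := fun m => (((K + Q₂ m : ℕ) : ℝ) + ((Λb m * G : ℕ) : ℝ)) /
    (((Λb m * G : ℕ) : ℝ) - ((K + Q₂ m : ℕ) : ℝ)) with hA
  set Dm : ℕ → ℝ := fun m => ((Λb m * G : ℕ) : ℝ) - ((K + Q₂ m : ℕ) : ℝ) with hDm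
  set θ : ℝ := (θn : ℝ) / θd with hθdef
  set As : ℝ := ((1 - θ) * K + (1 + θ) * ((G : ℝ) * (Λ0 + s * H))) / ((1 - θ) * ((G : ℝ) * Λ0 - K)) with hAs
  set D₀ : ℝ := (1 - θ) * ((G : ℝ) * Λ0 - K) with hD₀
  set rs : ℝ := ((cd : ℝ) + cn) / ((cd : ℝ) - cn) with hrs
  have hθdr : (0 : ℝ) < θd := by exact_mod_cast hθd
  have hθ1 : θ < 1 := by rw [hθdef, div_lt_one hθdr]; exact_mod_cast hθ
  have hθ0 : 0 ≤ θ := by positivity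
  have hKr : (K : ℝ) < (G : ℝ) * Λ0 := by exact_mod_cast hK
  have hD₀pos : 0 < D₀ := by rw [hD₀]; nlinarith
  -- block facts
  have hΛ0 : Λb 0 = Λ0 := thin_blocks_zero Λ0 s H
  have hge : ∀ m, Λ0 ≤ Λb m := fun m => thin_blocks_ge Λ0 s H m
  have hKm : ∀ m, K < G * Λb m := fun m => thin_K_lt_of_le hK (hge m)
  have hΛQ : ∀ m, K + Q₂ m < Λb m * G := fun m => thin_strip_shift hθ (hKm m)
  have hsep : ∀ m, θd * (u' * Λb (m + 1) + v') ≤ v' * θn * (G * Λb m - K) := fun m => thin_sep_all hK.le hsep0 hsepi hsepH m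
  have hQ : ∀ m, Q₁ m < Q₂ m := fun m => thin_Q₁_lt_Q₂ hv' hθd (hsep m)
  have hfeed : ∀ m, u' * Λb (m + 1) ≤ v' * (Q₁ m + 1) := fun m => thin_feed u' hv' (Λb (m + 1))
  have hhead : ∀ m, m < H → Λb (m + 1) = Λb m + s := fun m hm => thin_blocks_succ_head hm
  have htail : ∀ m, H ≤ m → Λb (m + 1) = 2 * Λb m := fun m hm => thin_blocks_succ_tail hm
  have hge0 : ∀ m, Λb 0 ≤ Λb m := fun m => by rw [hΛ0]; exact hge m
  have hK0 : K ≤ G * Λb 0 := by rw [hΛ0]; exact hK.le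
  have hfr0' : cd * (u' * Λb 1) ≤ cn * (v' * (θn * (G * Λb 0 - K) / θd)) := hfr0
  have hfrH' : cd * (u' * Λb (H + 1)) ≤ cn * (v' * (θn * (G * Λb H - K) / θd)) := hfrH
  have hrall : ∀ m, 0 ≤ ((Q₁ m : ℝ) + Q₂ m) / ((Q₂ m : ℝ) - Q₁ m) ∧ ((Q₁ m : ℝ) + Q₂ m) / ((Q₂ m : ℝ) - Q₁ m) ≤ rs :=
    fun m => thin_r_le_all hv' hcd hc hhead htail hge0 hK0 hfr0' hfri hfrH' hQ m
  -- the uniform constants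
  have hden : ∀ m, 0 < (1 - θ) * ((G : ℝ) * Λb m - K) ∧ (1 - θ) * ((G : ℝ) * Λb m - K) ≤ Dm m :=
    fun m => thin_den_ge hθd hθ (hKm m)
  have hDge : ∀ m, D₀ * (1 : ℝ) ^ m ≤ Dm m := fun m => by
    rw [one_pow, mul_one]
    refine le_trans ?_ (hden m).2
    have h1 : (Λ0 : ℝ) ≤ Λb m := by exact_mod_cast hge m
    have h2 : (G : ℝ) * Λ0 - K ≤ (G : ℝ) * Λb m - K := by
      have := mul_le_mul_of_nonneg_left h1 (Nat.cast_nonneg G); linarith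
    rw [hD₀]
    exact mul_le_mul_of_nonneg_left h2 (by linarith)
  have hDpos : ∀ m, 0 < Dm m := fun m => lt_of_lt_of_le (by simpa using hD₀pos) (hDge m)
  have hA1 : ∀ m, 1 ≤ A m := fun m => by
    have hd' := hDpos m
    rw [hA, one_le_div hd']
    have h1 : (0 : ℝ) ≤ ((K + Q₂ m : ℕ) : ℝ) := by positivity
    show ((Λb m * G : ℕ) : ℝ) - ((K + Q₂ m : ℕ) : ℝ) ≤ ((K + Q₂ m : ℕ) : ℝ) + ((Λb m * G : ℕ) : ℝ)
    linarith
  have hApos : ∀ m, 0 < A m := fun m => lt_of_lt_of_le one_pos (hA1 m)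
  have hAle : ∀ m, A m ≤ As := fun m => by
    have h1 := thin_A_le (θn := θn) (θd := θd) hθd hθ (hKm m)
    have hL : (G : ℝ) * Λ0 ≤ (G : ℝ) * Λb m := by
      have : (Λ0 : ℝ) ≤ Λb m := by exact_mod_cast hge m
      exact mul_le_mul_of_nonneg_left this (Nat.cast_nonneg _)
    have hLH : (G : ℝ) * Λ0 ≤ (G : ℝ) * (Λ0 + s * H) := mul_le_mul_of_nonneg_left (by
      have : (0 : ℝ) ≤ s * H := by positivity
      linarith) (Nat.cast_nonneg _)
    have h2 := thin_Abound_le_uniform (θ := θ) (K := (K : ℝ)) hθ0 hθ1 (Nat.cast_nonneg _) hKr hL hLH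
    exact h1.trans h2
  set d₀ : ℕ → ℝ := fun m => 1 / (2 * π * A m * Dm m) + Real.sqrt (4 * (M * P.δ j) / (π * A m * Dm m)) +
    M * P.δ j / (π * P.N j) with hd₀
  have hdpos : ∀ m, 0 < d₀ m := fun m => by
    have := hApos m; have := hDpos m
    positivity
  set ε₀ : ℕ → ℝ := fun m => A m * (2 * π * ((Λb (m + 1) * G : ℕ) : ℝ) * (Real.exp (-(M ^ 2 / 2)) / (2 * P.N j))) +
    2 * P.N j / (π * Dm m) with hε₀
  have hε0 : ∀ m, 0 ≤ ε₀ m := fun m => by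
    have := (hApos m).le; have := hDpos m
    positivity
  have hAs0 : 0 ≤ As := (hApos 0).le.trans (hAle 0)
  -- the multi-block step
  have hΛ01 : 1 ≤ Λb 0 := by
    rw [hΛ0]
    exact Nat.pos_of_ne_zero (by rintro rfl; simp at hK)
  have hY' : ∀ m, Y ≤ Q₁ m + 1 := fun m =>
    hY.trans (Nat.add_le_add_right (thin_Q₁_mono u' v' (thin_blocks_monotone Λ0 s H) (Nat.zero_le m)) 1)
  have hstep := tsum_strip_vstep_blocks_osc_le P hγ hδ₀ hd hN₀ hρN a b has h0 hb hab j K Λb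
    (thin_blocks_monotone Λ0 s H) hΛ01 Mb Q₁ Q₂
    hQ hΛQ hM hMδ d₀ ε₀ hdpos
    (fun m => oscDepth_hMd (M := M) (δ := P.δ j) (hApos m) (hDpos m) hN)
    (fun m => oscDepth_hAd (hApos m) (hDpos m) hN hMδ0.le) hε0 (fun m => le_rfl) (u' := u') (v' := v') (Y := Y)
    hfeed hY'
  -- the junk in closed form (no growth of the denominators used: `ρ = 1`, `S = M_b`)
  have hjunk := blockJunk_osc_sum_le_geom (r := fun m => ((Q₁ m : ℝ) + Q₂ m) / ((Q₂ m : ℝ) - Q₁ m)) (A := A) (D := Dm) (ε₀ := ε₀)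
    (rs := rs) (As := As) (D₀ := D₀) (e₀ := As * π * G * η * (Λ0 + s * H) / P.N j) (b₀ := 2 * P.N j / (π * D₀)) (N := (P.N j : ℝ))
    (Mδ := M * P.δ j) (ρ := 1) (S := Mb) hN hMδ0.le hD₀pos le_rfl
    (fun m => (hrall m).1) (fun m => (hrall m).2) hA1 hAle hDge hε0
    (by positivity) (by positivity) (fun m => ?_) Mb (sum_range_inv_pow_le_card le_rfl Mb)
  · -- assemble
    have e2N : ((2 * P.N j : ℕ) : ℝ) = 2 * (P.N j : ℝ) := by push_cast; ring
    rw [e2N, hΛ0] at hstep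
    exact le_add_sq_sqrt_add_mono hstep (hjunk.trans (le_of_eq rfl))
  · -- the rounding allowance on block `m`
    simp only [hε₀]
    have hA' := hAle m
    have hA0' := (hApos m).le
    have hΛle : ((Λb (m + 1) * G : ℕ) : ℝ) ≤ ((Λ0 : ℝ) + s * H) * 2 ^ (m + 1) * G := by
      have h1 : Λb (m + 1) ≤ (Λ0 + s * H) * 2 ^ (m + 1) := thin_blocks_le_top_pow Λ0 s H (m + 1)
      have h2 : ((Λb (m + 1) * G : ℕ) : ℝ) ≤ (((Λ0 + s * H) * 2 ^ (m + 1) * G : ℕ) : ℝ) := by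
        exact_mod_cast Nat.mul_le_mul_right _ h1
      refine h2.trans (le_of_eq ?_)
      push_cast; ring
    have hb : 2 * P.N j / (π * Dm m) ≤ 2 * P.N j / (π * D₀) * (1 / (1 : ℝ)) ^ m := by
      rw [div_one, one_pow, mul_one]
      exact div_le_div_of_nonneg_left (by positivity) (by positivity)
        (mul_le_mul_of_nonneg_left (by simpa using hDge m) Real.pi_pos.le)
    refine add_le_add ?_ hb
    calc A m * (2 * π * ((Λb (m + 1) * G : ℕ) : ℝ) * (Real.exp (-(M ^ 2 / 2)) / (2 * P.N j)))
        = A m * Real.exp (-(M ^ 2 / 2)) * (π / P.N j) * ((Λb (m + 1) * G : ℕ) : ℝ) := by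
          field_simp
      _ ≤ As * η * (π / P.N j) * (((Λ0 : ℝ) + s * H) * 2 ^ (m + 1) * G) :=
          mul_le_mul (mul_le_mul_of_nonneg_right (mul_le_mul hA' hMη (Real.exp_nonneg _) hAs0) (by positivity)) hΛle
            (by positivity) (by positivity)
      _ = As * π * G * η * (Λ0 + s * H) / P.N j * 2 ^ (m + 1) := by ring

end Cascade

end Summit.AnomalousDissipation.AnomalousDissipation.Theorems.SawtoothPulseCascade.K1Window
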